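import Summits.CriticalPhenomena.PercolationContinuityZ3.Theorems.PercNearOneGluingNoHeavyLowerTailSahiE3IndepOrRankOneCap
import Mathlib.Tactic.Linarith
import Mathlib.Tactic.Ring
import Mathlib.Tactic.Positivity
import HarnessLib
import HarnessLib.Audit

/-!
# `NoHeavyLowerTail` (crux stmt-CriticalPhenomena-4575), Sahi programme P4 (Holley / monotone coupling):
# the independent OR-step `V ∨ G` — the flat-θ composites satisfy the CAP inequality for every θ ∈ [0,1]

Support file (cell `prim-l12`, seat P4, generation 18; `--supports stmt-CriticalPhenomena-4575`).  No named facts, no sorries;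
standard axioms; def-free.

Setting (normalised sandwich form, `…SahiE3CertSandwich`): finite posets `B, Q`, weights `w, ν' ≥ 0` of total mass `1`, subsets
`V ⊆ B` (`v = w(V)`, `v̄ = w(Vᶜ)`), `G ⊆ Q` (`g = ν'(G)`, `ḡ = ν'(Gᶜ)`), functions `R_V ≥ 0` on `B` and `R_G ≥ 0` on `Q` satisfying the
CAP inequalities of their own slots, `(C_V)  R_V(I) + v·w(I ∖ V) ≤ (1+v̄)·w(I ∩ V)` for up-sets `I ⊆ B` (and `(C_G)` likewise).  For a
parameter `θ` the FLAT-θ COMPOSITE on `B × Q` (slot `U = V × Q ∪ B × G`, `d = v̄ḡ`, `u = v + v̄g`) is the rank-one composite with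
  `φ_θ = c₁·R_V + κ₁·w` on `V`,  `ψ_θ = c₂·R_G + κ₂·ν'` on `G`,
  `c₁ = 1 − θg`, `κ₁ = g(θ(1+v̄) − v̄)`, `c₂ = v̄ + θv`, `κ₂ = v(1 − θ(1+ḡ))`
(θ = 0 and θ = 1 are the two orientations of `…SahiE3LroOrStep.cert_or_step` when one block is a single variable; θ = ½ is the averaged
composite of `…SahiE3IndepOrAvg`).  THEOREM `cap_flatTheta`: for `c₁, c₂ ≥ 0` (in particular for every `θ ∈ [0,1]`) the flat-θ composite
satisfies the cap inequality (C) `R(W) + u·ν(W ∖ U) ≤ (1+d)·ν(W ∩ U)` for every up-set `W` — by `…SahiE3IndepOrRankOneCap.cap_rankOne`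
with the split `μ_V = c₁v`, `μ_G = c₂g` (`c₁v + c₂g = u` exactly: the composite's deliveries are exact).  So for the whole flat-θ family
ONLY THE PAIR INEQUALITY (L) remains to be proved; numerically (HOME prim-l12-p4 gen-18 memo, exact exhaustive checks incl. the 64-point
flagship) it holds for every θ ∈ [0,1] when `R_V, R_G` are the natural certificates of read-once formulas, and exactly on [0,1].
-/

namespace Summit.CriticalPhenomena.PercolationContinuityZ3.Theorems.SahiE3IndepOrFlatTheta

open Finset SahiE3ProductSections SahiE3IndepOrRankOneCap
open scoped BigOperators

variable {B Q : Type*} [Fintype B] [DecidableEq B] [PartialOrder B] [Fintype Q] [DecidableEq Q] [PartialOrder Q]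

/-- One block of the flat-θ composite satisfies the decoupled cap condition: if `R(I) + v·w(I∖V) ≤ (1+v̄)·w(I∩V)` on up-sets,
`R ≥ 0`, `c ≥ 0` and `c(1+v̄) + κ = 1 + d`, then `φ = cR + κw` satisfies `φ(I∩V) + cv·w(I∖V) ≤ (1+d)·w(I∩V)`. [this work] -/
theorem block_cap {w R : B → ℝ} (hR : ∀ b, 0 ≤ R b) (V : Finset B) {v vb c κ d : ℝ} (hc : 0 ≤ c)
    (hck : c * (1 + vb) + κ = 1 + d)
    (hCV : ∀ I : Finset B, IsUpperSet (I : Set B) →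
      ∑ b ∈ I, R b + v * ∑ b ∈ I ∩ Vᶜ, w b ≤ (1 + vb) * ∑ b ∈ I ∩ V, w b)
    (φ : B → ℝ) (hφ : ∀ b ∈ V, φ b = c * R b + κ * w b)
    (I : Finset B) (hI : IsUpperSet (I : Set B)) :
    ∑ b ∈ I ∩ V, φ b + c * v * ∑ b ∈ I ∩ Vᶜ, w b ≤ (1 + d) * ∑ b ∈ I ∩ V, w b := by
  have h := hCV I hI
  have e : ∑ b ∈ I ∩ V, φ b = c * ∑ b ∈ I ∩ V, R b + κ * ∑ b ∈ I ∩ V, w b := by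
    rw [Finset.mul_sum, Finset.mul_sum, ← Finset.sum_add_distrib]
    exact Finset.sum_congr rfl fun b hb => by rw [hφ b (Finset.mem_inter.1 hb).2]
  have hsub : ∑ b ∈ I ∩ V, R b ≤ ∑ b ∈ I, R b :=
    Finset.sum_le_sum_of_subset_of_nonneg Finset.inter_subset_left fun b _ _ => hR b
  rw [e]
  have h2 : c * ∑ b ∈ I ∩ V, R b ≤ c * ((1 + vb) * ∑ b ∈ I ∩ V, w b - v * ∑ b ∈ I ∩ Vᶜ, w b) :=
    mul_le_mul_of_nonneg_left (by linarith) hc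
  have e2 : (1 + d) * ∑ b ∈ I ∩ V, w b = (c * (1 + vb) + κ) * ∑ b ∈ I ∩ V, w b := by rw [hck]
  rw [e2]
  nlinarith [h2]

/-- **The flat-θ composite satisfies the cap inequality.**  Weights `w, ν' ≥ 0`, `V ⊆ B`, `G ⊆ Q`, reals `v, v̄, g, ḡ` (in the application
the masses of `V, Vᶜ, G, Gᶜ`), `R_V, R_G ≥ 0` with the cap inequalities (C_V), (C_G) of their slots, coefficients `c₁, c₂ ≥ 0`, `κ₁, κ₂` with `c₁(1+v̄) + κ₁ = 1 + v̄ḡ = c₂(1+ḡ) + κ₂` and exact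
deliveries `c₁v + c₂g = v + v̄g` (all satisfied by the flat-θ coefficients, `flatTheta_coeffs`); then the rank-one composite with
`φ = c₁R_V + κ₁w`, `ψ = c₂R_G + κ₂ν'` satisfies (C) for `U = V ∨ G` and every up-set `W`. [this work] -/
theorem cap_flatTheta {w : B → ℝ} {ν' : Q → ℝ} (hw : ∀ b, 0 ≤ w b) (hν' : ∀ t, 0 ≤ ν' t)
    (V : Finset B) (G : Finset Q) {v vb g gb : ℝ}
    (RV : B → ℝ) (RG : Q → ℝ) (hRV0 : ∀ b, 0 ≤ RV b) (hRG0 : ∀ t, 0 ≤ RG t)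
    (hCV : ∀ I : Finset B, IsUpperSet (I : Set B) →
      ∑ b ∈ I, RV b + v * ∑ b ∈ I ∩ Vᶜ, w b ≤ (1 + vb) * ∑ b ∈ I ∩ V, w b)
    (hCG : ∀ J : Finset Q, IsUpperSet (J : Set Q) →
      ∑ t ∈ J, RG t + g * ∑ t ∈ J ∩ Gᶜ, ν' t ≤ (1 + gb) * ∑ t ∈ J ∩ G, ν' t)
    {c₁ κ₁ c₂ κ₂ : ℝ} (hc₁ : 0 ≤ c₁) (hc₂ : 0 ≤ c₂) (hk₁ : c₁ * (1 + vb) + κ₁ = 1 + vb * gb)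
    (hk₂ : c₂ * (1 + gb) + κ₂ = 1 + vb * gb) (hdel : c₁ * v + c₂ * g = v + vb * g)
    (φ : B → ℝ) (hφ : ∀ b ∈ V, φ b = c₁ * RV b + κ₁ * w b)
    (ψ : Q → ℝ) (hψ : ∀ t ∈ G, ψ t = c₂ * RG t + κ₂ * ν' t)
    (ν : B × Q → ℝ) (hν : ∀ x, ν x = w x.1 * ν' x.2)
    (R : B × Q → ℝ)
    (hR : ∀ x, R x = if x.1 ∈ V then (if x.2 ∈ G then (1 + vb * gb) * w x.1 * ν' x.2 else φ x.1 * ν' x.2)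
      else (if x.2 ∈ G then w x.1 * ψ x.2 else 0))
    (U : Finset (B × Q)) (hU : ∀ x, x ∈ U ↔ (x.1 ∈ V ∨ x.2 ∈ G))
    (W : Finset (B × Q)) (hW : IsUpperSet (W : Set (B × Q))) :
    ∑ x ∈ W, R x + (v + vb * g) * ∑ x ∈ W ∩ Uᶜ, ν x ≤ (1 + vb * gb) * ∑ x ∈ W ∩ U, ν x := by
  have hV := fun (I : Finset B) (hI : IsUpperSet (I : Set B)) => block_cap hRV0 V hc₁ hk₁ hCV φ hφ I hI
  have hG := fun (J : Finset Q) (hJ : IsUpperSet (J : Set Q)) => block_cap hRG0 G hc₂ hk₂ hCG ψ hψ J hJ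
  exact cap_rankOne hw hν' V G (v + vb * g) (vb * gb) (c₁ * v) (c₂ * g) (by linarith) φ ψ hV hG ν hν R hR U hU W hW

/-- The flat-θ coefficients satisfy the hypotheses of `cap_flatTheta` for `θ ∈ [0,1]` (`v + v̄ = 1 = g + ḡ`, all in `[0,1]`):
`c₁ = 1 − θg ≥ 0`, `c₂ = v̄ + θv ≥ 0`, `c₁(1+v̄) + κ₁ = 1+v̄ḡ = c₂(1+ḡ) + κ₂`, `c₁v + c₂g = v + v̄g`. [this work] -/
theorem flatTheta_coeffs {v vb g gb θ : ℝ} (hv0 : 0 ≤ v) (hvb0 : 0 ≤ vb) (hv1 : v + vb = 1) (hg0 : 0 ≤ g) (hg1 : g + gb = 1)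
    (hgb0 : 0 ≤ gb) (hθ0 : 0 ≤ θ) (hθ1 : θ ≤ 1) :
    0 ≤ 1 - θ * g ∧ 0 ≤ vb + θ * v ∧
      (1 - θ * g) * (1 + vb) + g * (θ * (1 + vb) - vb) = 1 + vb * gb ∧
      (vb + θ * v) * (1 + gb) + v * (1 - θ * (1 + gb)) = 1 + vb * gb ∧
      (1 - θ * g) * v + (vb + θ * v) * g = v + vb * g := by
  refine ⟨?_, by positivity, ?_, ?_, ?_⟩
  · have hg1' : g ≤ 1 := by linarith
    nlinarith [mul_le_mul hθ1 hg1' hg0 zero_le_one]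
  · have : gb = 1 - g := by linarith
    subst this; ring
  · have : gb = 1 - g := by linarith
    subst this
    have : vb = 1 - v := by linarith
    subst this; ring
  · have : vb = 1 - v := by linarith
    subst this; ring

end Summit.CriticalPhenomena.PercolationContinuityZ3.Theorems.SahiE3IndepOrFlatTheta
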